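import Summits.CriticalPhenomena.PercolationContinuityZ3.Theorems.PercNearOneGluingNoHeavyLowerTailKNGoodSinglePort
import HarnessLib

/-!
# Kozma–Nitzan's Theorem 5 with an additional single-port pendant child
# (`NoHeavyLowerTail` cell, stmt-CriticalPhenomena-4575; prover `prim-hp-2`, deletion–contraction line, gen 4)

Support file (`--supports stmt-CriticalPhenomena-4575`).  No definitions, no named facts, no sorries.
Kozma–Nitzan's Theorem 5: `o` joined to relays and to ONE vertex `y` with `(G − o, A, y, b)` good ⇒ `(G, A, o, b)` good.  Here `o` may have, in
addition, a second child `x` that is a pendant vertex with a SINGLE relay port `p` (a "lonely leg" `o – x – p`), provided `y` is also good in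
`G − o − x`.  Proof = the series reduction (`KNGoodSeries.knGood_series_of_gluing`) + the gluing inequality by affinity in the single hair
(`KNGoodSinglePort`): at hair weight `1` two gluing transfers, at hair weight `0` the corner transport `KNGoodSeries.agood_wzero_glue_one`
(an isolated twin glued to the observer = the observer alone in the twin-deleted graph) and the invisibility of a pendant pair
(`KNGoodSinglePort.real_openConn_update_pendant`).

* `KNGoodThm5SinglePort.pinW_star_eq_update_of_pendant` — `G − x = u[s(x,p) ↦ 0]` for a pendant `x` with unique port `p`.
* `KNGoodThm5SinglePort.gc_of_singlePort_of_good` — GC for `x` single-port, `y` arbitrary good in `G − o − x`.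
* `KNGoodThm5SinglePort.knGood_thm5_singlePort` — the theorem.
-/

noncomputable section

namespace Summit.CriticalPhenomena.PercolationContinuityZ3.Theorems

open MeasureTheory Set Literature.Probability.LatticeModels Literature.Probability.Percolation
open scoped Classical BigOperators

variable {n : ℕ}

namespace KNGoodThm5SinglePort

open ChampionStability KNGoodAux KNGoodHair RelayNbhd CILTwoSteiner KNGoodSeries KNGoodSeriesEasy KNGoodLoser KNGoodPortFree KNGoodHubStar
  KNGoodSinglePort


/-- If every pair at `x` other than `s(x,p)` is `0`, then `G − x` (all pairs at `x` pinned closed) is `u[s(x,p) ↦ 0]`. [folklore] -/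
theorem pinW_star_eq_update_of_pendant (u : Sym2 (Fin n) → unitInterval) (x p : Fin n) (hpx : p ≠ x)
    (hpend : ∀ z : Fin n, z ≠ x → z ≠ p → u s(x, z) = 0) :
    pinW u {e : Sym2 (Fin n) | x ∈ e ∧ ¬ e.IsDiag} ∅ = Function.update u s(x, p) 0 := by
  funext e
  by_cases hmem : e ∈ {e : Sym2 (Fin n) | x ∈ e ∧ ¬ e.IsDiag}
  · obtain ⟨hxe, hdiag⟩ := hmem
    obtain ⟨z, rfl⟩ : ∃ z, e = s(x, z) := by
      induction e using Sym2.ind with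
      | h c d =>
        rcases Sym2.mem_iff.1 hxe with h | h
        · exact ⟨d, by rw [h]⟩
        · exact ⟨c, by rw [h, Sym2.eq_swap]⟩
    have hzx : z ≠ x := by
      intro hz; apply hdiag; rw [hz]; exact Sym2.mk_isDiag_iff.2 rfl
    rw [pinW_star_mk u hzx]
    by_cases hzp : z = p
    · rw [hzp, Function.update_self]
    · rw [Function.update_of_ne (fun h => hzp (Sym2.congr_right.1 h)), hpend z hzx hzp]
  · have hne : e ≠ s(x, p) := by
      intro he; apply hmem; rw [he]
      exact ⟨Sym2.mem_mk_left x p, fun hd => hpx (Sym2.mk_isDiag_iff.1 hd).symm⟩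
    rw [pinW_apply_of_not_mem u ∅ hmem, Function.update_of_ne hne]

/-- **GC when the child `x` has a single port and the other child `y` is ARBITRARY but good with `x` deleted.**  `x, y ∉ A`, `x ≠ y`; in
`u = G − o` the only possibly-positive pair at `x` is `s(x,p)` (`p ∈ A`); `(G − o − x, A, y, b)` is good, where `G − o − x = pinW u {pairs at x} ∅`;
`a₀` minimises `P_u(· ↔ b)` over `A`.  Then `agood(u[s(x,y) ↦ 1], x; a₀) ≥ 0` — Kozma–Nitzan's Theorem 5 hypothesis for `y`, plus one extra
lonely leg `o – x – p`. [cite: KozmaNitzan2024, Thm. 5 (p. 13), Lemma 5 (p. 13) — extension] -/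
theorem gc_of_singlePort_of_good (u : Sym2 (Fin n) → unitInterval) (A : Finset (Fin n)) (hA : A.Nonempty)
    (x y p a₀ b : Fin n) (hx : x ∉ A) (hy : y ∉ A) (hxy : x ≠ y) (hp : p ∈ A) (ha₀ : a₀ ∈ A) (hbx : b ≠ x)
    (hxpend : ∀ z : Fin n, z ≠ x → z ≠ p → u s(x, z) = 0)
    (hgoody : KNGood (pinW u {e : Sym2 (Fin n) | x ∈ e ∧ ¬ e.IsDiag} ∅) A hA y b)
    (hmin : ∀ a' ∈ A, (prodBernoulli u).real (openConn a₀ b) ≤ (prodBernoulli u).real (openConn a' b)) :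
    0 ≤ (prodBernoulli (Function.update u s(x, y) 1)).real (openConn x b) -
        (prodBernoulli (Function.update u s(x, y) 1)).real (openConn a₀ b) +
        ∑ W ∈ nullSets A, (prodBernoulli (Function.update u s(x, y) 1)).real (clusterIs x W) *
          A.inf' hA (fun a' => (prodBernoulli (Function.update u s(x, y) 1)).real (openConnIn ((↑W : Set (Fin n))ᶜ) a' b)) := by
  haveI : ∀ v : Sym2 (Fin n) → unitInterval, IsProbabilityMeasure (prodBernoulli v) := fun v => inferInstance
  set us := Function.update u s(x, y) 1 with hus
  have hpx : p ≠ x := fun h => hx (h ▸ hp)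
  have hpy : p ≠ y := fun h => hy (h ▸ hp)
  have hne : s(x, y) ≠ s(x, p) := fun h => hpy (Sym2.congr_right.1 h).symm
  -- affinity in the single hair `s(x,p)`
  have haff := agood_affine_pair us A hA x p a₀ b (us s(x, p))
  rw [Function.update_eq_self] at haff
  rw [haff]
  have h0p : 0 ≤ (us s(x, p) : ℝ) := (us s(x, p)).2.1
  have h1p : (us s(x, p) : ℝ) ≤ 1 := (us s(x, p)).2.2
  -- value at `h = 1`: two gluing transfers
  have hD1 : 0 ≤ ∑ W ∈ nullSets A, (prodBernoulli (Function.update us s(x, p) 1)).real (clusterIs x W) *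
      A.inf' hA (fun a' => (prodBernoulli (Function.update us s(x, p) 1)).real (openConnIn ((↑W : Set (Fin n))ᶜ) a' b)) := by
    refine Finset.sum_nonneg fun W _ => mul_nonneg measureReal_nonneg ?_
    exact (Finset.le_inf'_iff hA _).2 fun a _ => measureReal_nonneg
  have hval1 : (prodBernoulli (Function.update us s(x, p) 1)).real (openConn a₀ b) ≤
      (prodBernoulli (Function.update us s(x, p) 1)).real (openConn x b) := by
    have hcomm : Function.update us s(x, p) 1 = Function.update (Function.update u s(x, p) 1) s(x, y) 1 := by
      rw [hus, Function.update_comm hne]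
    rw [hcomm]
    have h1 : (prodBernoulli (Function.update u s(x, p) 1)).real (openConn a₀ b) ≤
        (prodBernoulli (Function.update u s(x, p) 1)).real (openConn x b) :=
      glueTransfer_openConn u x p a₀ b (Ne.symm hpx) (hmin p hp)
    have h2 := glueTransfer_openConn (Function.update u s(x, p) 1) y x a₀ b (Ne.symm hxy) h1
    rw [show s(y, x) = s(x, y) from Sym2.eq_swap] at h2
    rw [← real_openConn_update_one_glued (Function.update u s(x, p) 1) x y b hxy]
    exact h2
  -- value at `h = 0`: `x` isolated and glued to `y` = `G − o − x` observed from `y` (corner transport `agood_wzero_glue_one`)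
  set u1 := pinW u {e : Sym2 (Fin n) | x ∈ e ∧ ¬ e.IsDiag} ∅ with hu1
  have hu1' : u1 = Function.update u s(x, p) 0 := pinW_star_eq_update_of_pendant u x p hpx hxpend
  have hu0 : Function.update us s(x, p) 0 = Function.update u1 s(x, y) 1 := by
    rw [hu1', hus, Function.update_comm hne]
  have hcorner := agood_wzero_glue_one u A hA x y a₀ b hx (Ne.symm hxy) ha₀ hbx
  rw [← hu1] at hcorner
  -- relays: `P_{u1}(v ↔ b) = P_u(v ↔ b)` (the pendant pair is invisible)
  have hrel : ∀ v ∈ A, (prodBernoulli u1).real (openConn v b) = (prodBernoulli u).real (openConn v b) := by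
    intro v hv
    have hvx : v ≠ x := fun h => hx (h ▸ hv)
    have h := real_openConn_update_pendant u x p v b hpx hvx hbx hxpend 0 (u s(x, p))
    rw [Function.update_eq_self] at h
    rw [hu1']; exact h
  have hmin1 : ∀ a' ∈ A, (prodBernoulli u1).real (openConn a₀ b) ≤ (prodBernoulli u1).real (openConn a' b) := by
    intro a' ha'; rw [hrel a₀ ha₀, hrel a' ha']; exact hmin a' ha'
  have hval0 : 0 ≤ (prodBernoulli (Function.update us s(x, p) 0)).real (openConn x b) -
      (prodBernoulli (Function.update us s(x, p) 0)).real (openConn a₀ b) +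
      ∑ W ∈ nullSets A, (prodBernoulli (Function.update us s(x, p) 0)).real (clusterIs x W) *
        A.inf' hA (fun a' => (prodBernoulli (Function.update us s(x, p) 0)).real (openConnIn ((↑W : Set (Fin n))ᶜ) a' b)) := by
    rw [hu0, hcorner]
    have hg := hgoody
    rw [KNGood] at hg
    have hle : (prodBernoulli u1).real (openConn a₀ b) ≤ A.inf' hA (fun a' => (prodBernoulli u1).real (openConn a' b)) :=
      (Finset.le_inf'_iff hA _).2 hmin1
    linarith
  have t1 : 0 ≤ (1 - (us s(x, p) : ℝ)) * ((prodBernoulli (Function.update us s(x, p) 0)).real (openConn x b) -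
      (prodBernoulli (Function.update us s(x, p) 0)).real (openConn a₀ b) +
      ∑ W ∈ nullSets A, (prodBernoulli (Function.update us s(x, p) 0)).real (clusterIs x W) *
        A.inf' hA (fun a' => (prodBernoulli (Function.update us s(x, p) 0)).real (openConnIn ((↑W : Set (Fin n))ᶜ) a' b))) :=
    mul_nonneg (by linarith) hval0
  have t2 : 0 ≤ (us s(x, p) : ℝ) * ((prodBernoulli (Function.update us s(x, p) 1)).real (openConn x b) -
      (prodBernoulli (Function.update us s(x, p) 1)).real (openConn a₀ b) +
      ∑ W ∈ nullSets A, (prodBernoulli (Function.update us s(x, p) 1)).real (clusterIs x W) *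
        A.inf' hA (fun a' => (prodBernoulli (Function.update us s(x, p) 1)).real (openConnIn ((↑W : Set (Fin n))ᶜ) a' b))) :=
    mul_nonneg h0p (by linarith)
  linarith

/-- **Kozma–Nitzan's Theorem 5 with an additional single-port pendant child.**  `o ∉ A` with relay hairs and two non-relay neighbours `x ≠ y`
(`≠ o`, `b ∉ {o, x}`): `x` a pendant vertex whose only possibly-positive pairs are `s(x,o)` and `s(x,p)` (`p ∈ A`); `y` ARBITRARY with
`(G − o, A, y, b)` and `(G − o − x, A, y, b)` good (`G − o = pinW w {pairs at o} ∅`, and `G − o − x` = the same then pinned at `x`).  Then `(G, A, o, b)`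
is good.  (Theorem 5 is the case without `x`; gen-3's `knGood_thm5_notLonely` adds NON-lonely children; here the extra child may be lonely.)
[cite: KozmaNitzan2024, Thm. 5 (p. 13) — extension] -/
theorem knGood_thm5_singlePort (w : Sym2 (Fin n) → unitInterval) (A : Finset (Fin n)) (hA : A.Nonempty)
    (o x y p b : Fin n) (ho : o ∉ A) (hx : x ∉ A) (hy : y ∉ A) (hxo : x ≠ o) (hyo : y ≠ o) (hxy : x ≠ y)
    (hbo : b ≠ o) (hbx : b ≠ x) (hp : p ∈ A)
    (hoN : ∀ v : Fin n, v ≠ o → v ∉ A → v ≠ x → v ≠ y → w s(o, v) = 0)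
    (hxN : ∀ z : Fin n, z ≠ x → z ≠ p → z ≠ o → w s(x, z) = 0)
    (hgoody : KNGood (pinW w {e : Sym2 (Fin n) | o ∈ e ∧ ¬ e.IsDiag} ∅) A hA y b)
    (hgoody' : KNGood (pinW (pinW w {e : Sym2 (Fin n) | o ∈ e ∧ ¬ e.IsDiag} ∅) {e : Sym2 (Fin n) | x ∈ e ∧ ¬ e.IsDiag} ∅) A hA y b) :
    KNGood w A hA o b := by
  haveI : ∀ v : Sym2 (Fin n) → unitInterval, IsProbabilityMeasure (prodBernoulli v) := fun v => inferInstance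
  set w' : Sym2 (Fin n) → unitInterval := fun e => if ∃ q ∈ A, e = s(o, q) then 0 else w e with hw'
  refine knGood_of_deleteHairs w A hA o b ho ?_
  rw [← hw']
  have hpin : pinW w' {e : Sym2 (Fin n) | o ∈ e ∧ ¬ e.IsDiag} ∅ = pinW w {e : Sym2 (Fin n) | o ∈ e ∧ ¬ e.IsDiag} ∅ := by
    refine pinW_star_eq_of_eqOff w w' o fun e he => ?_
    rw [hw']; simp only
    rw [if_neg]
    rintro ⟨q, hq, rfl⟩
    exact he ⟨Sym2.mem_mk_left o q, fun hd => ho ((Sym2.mk_isDiag_iff.1 hd) ▸ hq)⟩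
  set u := pinW w {e : Sym2 (Fin n) | o ∈ e ∧ ¬ e.IsDiag} ∅ with hu
  have huoff : ∀ c d : Fin n, c ≠ o → d ≠ o → u s(c, d) = w s(c, d) := by
    intro c d hc hd
    have hmem : s(c, d) ∉ {e : Sym2 (Fin n) | o ∈ e ∧ ¬ e.IsDiag} := by
      rintro ⟨hoe, -⟩
      rcases Sym2.mem_iff.1 hoe with h | h
      · exact hc h.symm
      · exact hd h.symm
    rw [hu, pinW_apply_of_not_mem w ∅ hmem]
  have huo : ∀ v : Fin n, v ≠ o → u s(v, o) = 0 := by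
    intro v hv; rw [Sym2.eq_swap, hu]; exact pinW_star_mk w hv
  have hxpend : ∀ z : Fin n, z ≠ x → z ≠ p → u s(x, z) = 0 := by
    intro z hzx hzp
    by_cases hzo : z = o
    · rw [hzo]; exact huo x hxo
    · rw [huoff x z hxo hzo]; exact hxN z hzx hzp hzo
  have hgoodx : KNGood u A hA x b := by
    refine KozmaNitzan2024_thm4_good u A hA x b hx fun q hqx hqA => hxpend q hqx (fun h => hqA (h ▸ hp))
  obtain ⟨a₀, ha₀, hmin⟩ := A.exists_min_image (fun a => (prodBernoulli u).real (openConn a b)) hA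
  have hGC := gc_of_singlePort_of_good u A hA x y p a₀ b hx hy hxy hp ha₀ hbx hxpend hgoody' hmin
  exact knGood_series_of_gluing w' A hA o x y a₀ b ho hxo hyo hxy ha₀ hbo
    (fun v hvo hvx hvy => by
      rw [hw']; simp only
      by_cases hvA : v ∈ A
      · rw [if_pos ⟨v, hvA, rfl⟩]; rfl
      · rw [if_neg]
        · exact congrArg Subtype.val (hoN v hvo hvA hvx hvy)
        · rintro ⟨q, hq, hvq⟩
          exact hvA ((Sym2.congr_right.1 hvq) ▸ hq))
    (by rw [hpin]; exact hmin) (by rw [hpin]; exact hgoodx) (by rw [hpin]; exact hgoody) (by rw [hpin]; linarith [hGC])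

end KNGoodThm5SinglePort

end Summit.CriticalPhenomena.PercolationContinuityZ3.Theorems

end
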